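import Mathlib
import Summits.Ventures.PercRepro2.Tail2DBlockCalc
import Summits.Ventures.PercRepro2.Tail2DHarrisSP
import Summits.Ventures.PercRepro2.Tail2DFlowOneBlocks
import Summits.Ventures.PercRepro2.Tail2DFlowOneStep01
import Summits.Ventures.PercRepro2.Tail2DParFin
import Summits.Ventures.PercRepro2.Tail2DParFinFlip
import Summits.Ventures.PercRepro2.Tail2DParFinTop
import Summits.Ventures.PercRepro2.Tail2DParFinDiag
import Summits.Ventures.PercRepro2.Tail2DParFinCount
import Summits.Ventures.PercRepro2.Tail2DParFinRelax
import Summits.Ventures.PercRepro2.Tail2DParFinSubTop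
import Summits.Ventures.PercRepro2.Tail2DParFinSubTopB

/-!
# The one-change certificate for (SD) on `k` flow-one factors, with ARBITRARY rate tables
(seat mine-b, cell pub-perc-repro2; conjectures/MINE-B.md §44)

The sub-top certificate (Tail2DParFinSubTop*) is one instance of a general shape: at a position `(u, v)` every
source configuration STAYS (rate `ι w`, only for the common words `#B ≥ v + 1`), FLIPS one red factor `i`
(rate `f w i`) or RELAXES one red factor `i` (`R → col`, rate `x w i`, only for common words).  This file abstracts
the rate table into `OCRates` and rebuilds the blocks, weights, dominations and non-emptiness for an arbitrary
table; the coverage and the theorem (Tail2DOneChangeB) then need only the two per-word identities and the positivity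
of the rates — the combinatorial content of a certificate — so that every future position of the family is landed
by exhibiting its rate table.
-/

namespace Summit.Ventures.PercRepro2.Tail2D

open V2Closure Finset

section OneChange

variable (k : ℕ) (X : Fin k → V2Closure.SP) (u v : ℕ)

/-- a one-change rate table: the identity rate of a word, the flip rate and the relax rate of a word at a position -/
structure OCRates where
  /-- the identity rate (used for the common words) -/
  ι : (Fin k → Ltr) → ℚ
  /-- the flip rate at a red position -/
  f : (Fin k → Ltr) → Fin k → ℚ
  /-- the relax rate at a red position (used for the common words) -/
  x : (Fin k → Ltr) → Fin k → ℚ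


/-- a source word: `#R ≥ u`, `#B ≥ v` -/
abbrev ocSrc (w : Fin k → Ltr) : Prop := u ≤ nR k w ∧ v ≤ nB k w
/-- a common word: a source word with at least `v + 1` blues (in both tails; the words that may stay or relax) -/
abbrev ocCom (w : Fin k → Ltr) : Prop := ocSrc k u v w ∧ v + 1 ≤ nB k w
/-- an identity index (`m = 0`): a common word -/
abbrev ocId (w : Fin k → Ltr) (_i : Fin k) (m : Fin 3) : Prop := m = 0 ∧ ocCom k u v w
/-- a flip index (`m = 1`): a source word and one of its reds -/
abbrev ocFl (w : Fin k → Ltr) (i : Fin k) (m : Fin 3) : Prop := m = 1 ∧ ocSrc k u v w ∧ w i = Ltr.R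
/-- a relax index (`m = 2`): a common word and one of its reds -/
abbrev ocRx (w : Fin k → Ltr) (i : Fin k) (m : Fin 3) : Prop := m = 2 ∧ ocCom k u v w ∧ w i = Ltr.R

/-- the source block of an index -/
def ocP (w : Fin k → Ltr) (i : Fin k) (m : Fin 3) : Finset (parFin k X).Conf :=
  if ocId k u v w i m ∨ ocFl k u v w i m ∨ ocRx k u v w i m then blockOf k X w else ∅

/-- the target block of an index -/
def ocQ (w : Fin k → Ltr) (i : Fin k) (m : Fin 3) : Finset (parFin k X).Conf :=
  if ocId k u v w i m then blockOf k X w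
  else if ocFl k u v w i m then blockOf k X (flipSet k w {i})
  else if ocRx k u v w i m then blockCol k X w i else ∅

variable {k X u v}

/-- every index is a product coupling -/
theorem ocP_dom (hX : ∀ i, FlowOne (X i)) (w : Fin k → Ltr) (i : Fin k) (m : Fin 3) :
    BlockDom (parFin k X) (ocP k X u v w i m) (ocQ k X u v w i m) := by
  unfold ocP ocQ
  by_cases h1 : ocId k u v w i m
  · rw [if_pos (Or.inl h1), if_pos h1]; exact blockDom_refl _ _
  · rw [if_neg h1]
    by_cases h2 : ocFl k u v w i m
    · rw [if_pos (Or.inr (Or.inl h2)), if_pos h2]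
      apply blockOf_dom
      intro j
      by_cases hj : j = i
      · subst hj; right; exact ⟨h2.2.2, by simp [flipSet]⟩
      · left; simp [flipSet, hj]
    · rw [if_neg h2]
      by_cases h3 : ocRx k u v w i m
      · rw [if_pos (Or.inr (Or.inr h3)), if_pos h3]
        exact blockDom_col k X hX w i h3.2.2
      · rw [if_neg (fun h => h.elim h1 (fun h => h.elim h2 h3)), if_neg h3]
        exact blockDom_refl _ _

/-- an identity index is not a flip index -/
theorem ocId_not_fl (w : Fin k → Ltr) (i : Fin k) (m : Fin 3) (h : ocId k u v w i m) : ¬ ocFl k u v w i m :=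
  fun h' => by rw [h.1] at h'; exact absurd h'.1 (by decide)

/-- an identity index is not a relax index -/
theorem ocId_not_rx (w : Fin k → Ltr) (i : Fin k) (m : Fin 3) (h : ocId k u v w i m) : ¬ ocRx k u v w i m :=
  fun h' => by rw [h.1] at h'; exact absurd h'.1 (by decide)

/-- a flip index is not a relax index -/
theorem ocFl_not_rx (w : Fin k → Ltr) (i : Fin k) (m : Fin 3) (h : ocFl k u v w i m) : ¬ ocRx k u v w i m :=
  fun h' => by rw [h.1] at h'; exact absurd h'.1 (by decide)

variable (k X u v)

/-- the weight of an index, for a rate table -/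
noncomputable def ocW (R : OCRates k) (w : Fin k → Ltr) (i : Fin k) (m : Fin 3) : ℚ :=
  if ocId k u v w i m then R.ι w * (blockOf k X w).card / (tailCount (parFin k X) u v * k)
  else if ocFl k u v w i m then R.f w i * (blockOf k X w).card / tailCount (parFin k X) u v
  else if ocRx k u v w i m then R.x w i * (blockCol k X w i).card / tailCount (parFin k X) u v
  else 0

/-- the rate of an index (per configuration of its source word), for a rate table -/
noncomputable def ocRate (R : OCRates k) (w : Fin k → Ltr) (i : Fin k) (m : Fin 3) : ℚ :=
  if ocId k u v w i m then R.ι w / k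
  else if ocFl k u v w i m then R.f w i
  else if ocRx k u v w i m then R.x w i * (1 + gam k X i) else 0

variable {k X u v}

/-- the weights are non-negative when the rates are -/
theorem ocW_nonneg (R : OCRates k) (hι : ∀ w, 0 ≤ R.ι w) (hf : ∀ w i, 0 ≤ R.f w i) (hx : ∀ w i, 0 ≤ R.x w i)
    (w : Fin k → Ltr) (i : Fin k) (m : Fin 3) : 0 ≤ ocW k X u v R w i m := by
  unfold ocW
  have h1 := hι w; have h2 := hf w i; have h3 := hx w i
  split_ifs <;> positivity

/-- the block of a word updated by `B` at a position is non-empty when the block of the word is -/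
theorem card_blockOf_update_B_pos (hR : ∀ i, 0 < (rSet (X i)).card) (w : Fin k → Ltr) (i : Fin k)
    (hw : 0 < (blockOf k X w).card) : 0 < (blockOf k X (Function.update w i Ltr.B)).card := by
  rw [card_blockOf] at hw ⊢
  apply Finset.prod_pos
  intro j _
  by_cases hj : j = i
  · subst hj
    rw [Function.update_self]
    show 0 < (bSet (X j)).card
    rw [card_bSet_eq]; exact hR j
  · rw [Function.update_of_ne hj]
    exact Nat.pos_of_ne_zero (Finset.prod_ne_zero_iff.1 hw.ne' j (Finset.mem_univ j))

/-- a target block is non-empty when its source block is -/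
theorem ocQ_nonempty (hX : ∀ i, FlowOne (X i)) (hR : ∀ i, 0 < (rSet (X i)).card)
    (R : OCRates k) (w : Fin k → Ltr) (i : Fin k) (m : Fin 3) (_ : 0 < ocW k X u v R w i m)
    (hP : (ocP k X u v w i m).Nonempty) : (ocQ k X u v w i m).Nonempty := by
  unfold ocP at hP
  unfold ocQ
  by_cases h1 : ocId k u v w i m
  · rw [if_pos (Or.inl h1)] at hP
    rw [if_pos h1]; exact hP
  · rw [if_neg h1]
    by_cases h2 : ocFl k u v w i m
    · rw [if_pos (Or.inr (Or.inl h2))] at hP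
      rw [if_pos h2]
      apply Finset.card_pos.1
      rw [card_blockOf_flipSet k X w {i} (by
        intro j hj; rw [Finset.mem_singleton] at hj; subst hj
        simp [redSet, h2.2.2])]
      exact Finset.card_pos.2 hP
    · rw [if_neg h2]
      by_cases h3 : ocRx k u v w i m
      · rw [if_pos (Or.inr (Or.inr h3))] at hP
        rw [if_pos h3]
        apply Finset.card_pos.1
        rw [card_blockCol k X hX]
        have := card_blockOf_update_B_pos hR w i (Finset.card_pos.2 hP)
        omega
      · rw [if_neg (fun h => h.elim h1 (fun h => h.elim h2 h3))] at hP
        exact absurd hP Finset.not_nonempty_empty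

/-- the weight is the rate times `|w|/|E|` -/
theorem ocW_eq (hX : ∀ i, FlowOne (X i)) (hR : ∀ i, 0 < (rSet (X i)).card) (R : OCRates k)
    (w : Fin k → Ltr) (i : Fin k) (m : Fin 3) :
    ocW k X u v R w i m = ocRate k X u v R w i m * (blockOf k X w).card / tailCount (parFin k X) u v := by
  unfold ocW ocRate
  by_cases h1 : ocId k u v w i m
  · rw [if_pos h1, if_pos h1]; ring
  · rw [if_neg h1, if_neg h1]
    by_cases h2 : ocFl k u v w i m
    · rw [if_pos h2, if_pos h2]
    · rw [if_neg h2, if_neg h2]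
      by_cases h3 : ocRx k u v w i m
      · rw [if_pos h3, if_pos h3, card_blockCol_eq k X hX hR w i h3.2.2]; ring
      · rw [if_neg h3, if_neg h3]; ring

/-- the rate of an invalid index vanishes -/
theorem ocRate_eq_zero (R : OCRates k) (w : Fin k → Ltr) (i : Fin k) (m : Fin 3)
    (h : ¬ (ocId k u v w i m ∨ ocFl k u v w i m ∨ ocRx k u v w i m)) : ocRate k X u v R w i m = 0 := by
  unfold ocRate
  rw [if_neg (fun h1 => h (Or.inl h1)), if_neg (fun h2 => h (Or.inr (Or.inl h2))),
    if_neg (fun h3 => h (Or.inr (Or.inr h3)))]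

/-- the source term of an index at a configuration -/
theorem oc_src_term (hX : ∀ i, FlowOne (X i)) (hR : ∀ i, 0 < (rSet (X i)).card) (R : OCRates k)
    (w : Fin k → Ltr) (i : Fin k) (m : Fin 3) (z : (parFin k X).Conf) :
    ocW k X u v R w i m * unifDens (parFin k X) (ocP k X u v w i m) z
      = if wordOf k X z = w then ocRate k X u v R w i m / tailCount (parFin k X) u v else 0 := by
  rw [ocW_eq hX hR]
  unfold ocP
  by_cases hv : ocId k u v w i m ∨ ocFl k u v w i m ∨ ocRx k u v w i m
  · rw [if_pos hv, unifDens_blockOf k X hX]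
    by_cases h' : wordOf k X z = w
    · rw [if_pos h', if_pos h']
      have hpos : (0 : ℚ) < (blockOf k X w).card := by
        rw [← h']; exact_mod_cast card_blockOf_wordOf_pos k X hX z
      field_simp
    · rw [if_neg h', if_neg h', mul_zero]
  · rw [if_neg hv, unifDens_empty, ocRate_eq_zero R w i m hv]
    simp

/-- the three slices of the rate: `m = 0` -/
theorem ocRate_zero (R : OCRates k) (w : Fin k → Ltr) (i : Fin k) :
    ocRate k X u v R w i 0 = if ocCom k u v w then R.ι w / k else 0 := by
  unfold ocRate
  have h1 : ¬ ((0 : Fin 3) = 1) := by decide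
  have h2 : ¬ ((0 : Fin 3) = 2) := by decide
  by_cases h : ocCom k u v w
  · rw [if_pos ⟨rfl, h⟩, if_pos h]
  · rw [if_neg (fun hh => h hh.2), if_neg (fun hh => h1 hh.1), if_neg (fun hh => h2 hh.1), if_neg h]

/-- `m = 1` -/
theorem ocRate_one (R : OCRates k) (w : Fin k → Ltr) (i : Fin k) :
    ocRate k X u v R w i 1 = if ocSrc k u v w ∧ w i = Ltr.R then R.f w i else 0 := by
  unfold ocRate
  have h0 : ¬ ((1 : Fin 3) = 0) := by decide
  have h2 : ¬ ((1 : Fin 3) = 2) := by decide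
  rw [if_neg (fun hh => h0 hh.1)]
  by_cases h : ocSrc k u v w ∧ w i = Ltr.R
  · rw [if_pos ⟨rfl, h.1, h.2⟩, if_pos h]
  · rw [if_neg (fun hh => h ⟨hh.2.1, hh.2.2⟩), if_neg (fun hh => h2 hh.1), if_neg h]

/-- `m = 2` -/
theorem ocRate_two (R : OCRates k) (w : Fin k → Ltr) (i : Fin k) :
    ocRate k X u v R w i 2 = if ocCom k u v w ∧ w i = Ltr.R then R.x w i * (1 + gam k X i) else 0 := by
  unfold ocRate
  have h0 : ¬ ((2 : Fin 3) = 0) := by decide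
  have h1 : ¬ ((2 : Fin 3) = 1) := by decide
  rw [if_neg (fun hh => h0 hh.1), if_neg (fun hh => h1 hh.1)]
  by_cases h : ocCom k u v w ∧ w i = Ltr.R
  · rw [if_pos ⟨rfl, h.1, h.2⟩, if_pos h]
  · rw [if_neg (fun hh => h ⟨hh.2.1, hh.2.2⟩), if_neg h]

/-- **the source identity of a rate table**: for every source word,
`[common] ι + Σ_{i red} (f + [common] x (1 + γ_i)) = 1` -/
def OCRates.SrcOK (R : OCRates k) (X : Fin k → V2Closure.SP) (u v : ℕ) : Prop :=
  ∀ w : Fin k → Ltr, ocSrc k u v w →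
    (if ocCom k u v w then R.ι w else 0)
      + ∑ i ∈ redSet k w, (R.f w i + (if ocCom k u v w then R.x w i * (1 + gam k X i) else 0)) = 1

/-- the rates of a source word sum to one, given the source identity -/
theorem sum_ocRate (R : OCRates k) (hsrc : R.SrcOK X u v) (hk : 1 ≤ k) (w : Fin k → Ltr) :
    ∑ i, ∑ m, ocRate k X u v R w i m = if ocSrc k u v w then 1 else 0 := by
  simp only [Fin.sum_univ_three, ocRate_zero, ocRate_one, ocRate_two, Finset.sum_add_distrib]
  have hkpos : (0 : ℚ) < k := by exact_mod_cast (show 0 < k by omega)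
  by_cases hs : ocSrc k u v w
  · rw [if_pos hs]
    have e1 : ∀ i, (if ocSrc k u v w ∧ w i = Ltr.R then R.f w i else 0) = if w i = Ltr.R then R.f w i else 0 := by
      intro i
      by_cases hi : w i = Ltr.R
      · rw [if_pos ⟨hs, hi⟩, if_pos hi]
      · rw [if_neg (fun h => hi h.2), if_neg hi]
    have e2 : ∀ i, (if ocCom k u v w ∧ w i = Ltr.R then R.x w i * (1 + gam k X i) else 0)
        = if w i = Ltr.R then (if ocCom k u v w then R.x w i * (1 + gam k X i) else 0) else 0 := by
      intro i
      by_cases hi : w i = Ltr.R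
      · by_cases hc : ocCom k u v w
        · rw [if_pos ⟨hc, hi⟩, if_pos hi, if_pos hc]
        · rw [if_neg (fun h => hc h.1), if_pos hi, if_neg hc]
      · rw [if_neg (fun h => hi h.2), if_neg hi]
    have hA : ∑ i : Fin k, (if ocCom k u v w then R.ι w / k else 0) = if ocCom k u v w then R.ι w else 0 := by
      by_cases hc : ocCom k u v w
      · simp only [if_pos hc, Finset.sum_const, Finset.card_univ, Fintype.card_fin, nsmul_eq_mul]
        field_simp
      · simp only [if_neg hc, Finset.sum_const_zero]
    have hB : ∑ i, (if ocSrc k u v w ∧ w i = Ltr.R then R.f w i else 0) = ∑ i ∈ redSet k w, R.f w i := by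
      simp only [e1]; rw [← Finset.sum_filter]; rfl
    have hC : ∑ i, (if ocCom k u v w ∧ w i = Ltr.R then R.x w i * (1 + gam k X i) else 0)
        = ∑ i ∈ redSet k w, (if ocCom k u v w then R.x w i * (1 + gam k X i) else 0) := by
      simp only [e2]; rw [← Finset.sum_filter]; rfl
    rw [hA, hB, hC, add_assoc, ← Finset.sum_add_distrib]
    exact hsrc w hs
  · rw [if_neg hs]
    have e0 : (if ocCom k u v w then R.ι w / k else 0) = 0 := if_neg (fun h => hs h.1)
    have e1 : ∀ i, (if ocSrc k u v w ∧ w i = Ltr.R then R.f w i else 0) = 0 := fun i => if_neg (fun h => hs h.1)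
    have e2 : ∀ i, (if ocCom k u v w ∧ w i = Ltr.R then R.x w i * (1 + gam k X i) else 0) = 0 :=
      fun i => if_neg (fun h => hs h.1.1)
    simp only [e0, e1, e2, Finset.sum_const_zero, add_zero]

/-- **the source coverage of a one-change certificate** -/
theorem oc_src_cov (hX : ∀ i, FlowOne (X i)) (hR : ∀ i, 0 < (rSet (X i)).card) (R : OCRates k)
    (hsrc : R.SrcOK X u v) (hk : 1 ≤ k) (z : (parFin k X).Conf) :
    ∑ p : (Fin k → Ltr) × Fin k × Fin 3,
      ocW k X u v R p.1 p.2.1 p.2.2 * unifDens (parFin k X) (ocP k X u v p.1 p.2.1 p.2.2) z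
      = unifDens (parFin k X) (tailSet (parFin k X) u v) z := by
  set w0 := wordOf k X z with hw0
  set E : ℚ := (tailCount (parFin k X) u v : ℚ) with hE
  have hRHS : unifDens (parFin k X) (tailSet (parFin k X) u v) z = if ocSrc k u v w0 then E⁻¹ else 0 := by
    unfold unifDens
    rw [hE, tailCount_eq_card]
    by_cases h : z ∈ tailSet (parFin k X) u v
    · rw [if_pos h, if_pos ((mem_tailSet_parFin k X hX u v z).1 h)]
    · rw [if_neg h, if_neg (fun hh => h ((mem_tailSet_parFin k X hX u v z).2 hh))]
  rw [hRHS, Fintype.sum_prod_type]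
  simp only [oc_src_term hX hR R]
  rw [Finset.sum_eq_single w0]
  · rw [Fintype.sum_prod_type]
    simp only [← hw0, if_true, ← Finset.sum_div, sum_ocRate R hsrc hk]
    by_cases hs : ocSrc k u v w0
    · rw [if_pos hs, if_pos hs, one_div]
    · rw [if_neg hs, if_neg hs, zero_div]
  · intro w _ hw
    apply Finset.sum_eq_zero
    intro p _
    rw [if_neg (fun h => hw h.symm)]
  · intro h; exact absurd (Finset.mem_univ _) h

end OneChange

end Summit.Ventures.PercRepro2.Tail2D
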